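import Summits.BirchSwinnertonDyer.Rank1Residual.X11b.Three.RouteR1Tamagawa
import HarnessLib

/-!
# Leaf X8 (`p = 3`), erratum-type Heegner fields: the Tamagawa relation (C) at an ODD prime in
# CLAUSE form — `K` imaginary quadratic, `q ∣ d_K`, every other bad prime split, `d_K ≡ 1 (mod 8)` —
# so that it serves the rank-ZERO erratum datum (where `L(E^{(d_K)},1) = 0`) as well as rank one
# (cell `bsd-print-x8`, prover seat p4 «anticyclotomic ♯♭ / TWC road», gen 2; `--supports`
# stmt-BirchSwinnertonDyer-19004; THEOREMS ONLY — no definition, no named fact, no `sorry`)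

HONEST FRAMING (cell `bsd-print-x8`, HOME `run/shared/lean/pub/bsd-print-x8/`, D-0131 (2) PRINT
TIER). Bookkeeping only: «beyond-print theorem: NO»; 0 cells move; nothing about any curve asserted.
Team `x11b3` (cell `b2b-bsdres`) proved link (C) of Castella, Camb. J. Math. 6 (2018) §5 — the
Tamagawa relation `ord_p ∏_w c_w(E/K) = ord_p ∏_ℓ c_ℓ(E) + ord_p ∏_ℓ c_ℓ(E^{(d_K)})` — at every ODD
prime `p` on an erratum field for an odd multiplicative `q` with `p ∤ v_q(Δ_min)`
(`X11b.Three.tamagawaDescentAt_of_isErratumField_odd`, `Summits/…/X11b/Three/RouteR1Tamagawa{Places,}.lean`),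
under the bundled hypothesis `X11b.IsErratumField W K q`, whose fifth clause `L(E^{(d_K)},1) ≠ 0` is a
RANK-ONE datum and plays no role in the Tamagawa arithmetic. The rank-ZERO erratum road (this seat's
`SignedLowerHalvesSprungLowerDivisibilityAtThreeErratumField*.lean`; cell `bsd-print-x6`'s
`PrintX6AnticyclotomicRankZeroErratum.lean` at `p ≥ 5` used Castella 2018 §5's fact `hC5`, printed for
`p > 3`) needs (C) at a field where the twist has analytic rank ONE, so `L(E^{(d_K)},1) = 0`. This file
re-states x11b3's two theorems with `IsErratumField` replaced by the clauses actually used — proofs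
VERBATIM (adapted from the files named above; credit: team x11b3, seat p6).

* `padicValNat_sum_fibre_eq_of_erratumClauses_odd` — the per-place identity;
* `tamagawaDescentAt_of_erratumClauses_odd` — (C) `X11b.TamagawaDescentAt W p K Wd`;
* `discr_emod_eight_of_erratumClauses` — `d_K ≡ 1 (mod 8)` from the splitting clauses at an odd `q`
  (`2` splits in `K`: it is a bad prime `≠ q`, or `2 ∤ N` and the `2`-clause applies).

References: [Castella2018] §5 (arXiv:1704.06608 p. 12); [SilvermanATAEC1994] IV.9.4; [SilvermanAEC2009]
VII.6 Thm. 6.1; [JetchevSkinnerWan2017] §7.3.1 (eq:tamK); Marcus, *Number Fields*, Ch. 3 Thm. 25.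
-/

set_option autoImplicit false
set_option linter.dupNamespace false

noncomputable section

open scoped Classical

open WeierstrassCurve NumberField IsDedekindDomain Literature.NumberTheory.EllipticCurves
  Literature.NumberTheory.EllipticCurves.Rank1Residual
  Summit.BirchSwinnertonDyer.Rank1Residual Summit.BirchSwinnertonDyer.Rank1Residual.X11b
  Summit.BirchSwinnertonDyer.Rank1Residual.X11b.Three

namespace Summit.BirchSwinnertonDyer.BirchSwinnertonDyer.Theorems.X8ErratumField

/-! ### §1 The per-place identity, clause form (x11b3's proof verbatim) -/

/-- **The Tamagawa relation, one rational place at a time, at an ODD prime `p` — CLAUSE form**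
(the tree's `X11b.Three.padicValNat_sum_fibre_eq_of_isErratumField`, team x11b3, with the field
hypothesis `X11b.IsErratumField W K q` replaced by the three clauses its proof uses — `K` imaginary
quadratic, `q ∣ d_K`, every prime of `N_E` other than `q` split in `K` — plus `d_K ≡ 1 (mod 8)`; the
fifth clause of `IsErratumField`, `L(E^{(d_K)},1) ≠ 0`, is specific to analytic rank ONE of `E` and is
NOT used, so this form serves the rank-ZERO erratum datum too). `W/ℚ` globally minimal, `p` odd, `q`
a prime of multiplicative reduction with `p ∤ ord_q(Δ_min)`, `Wd = C • W^{(d_K)}`. For every finite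
place `v` of `ℚ`: `Σ_{w ∣ v} ord_p c_w(E_K) = ord_p c_v(E) + ord_p c_v(E^{(d_K)})` and
`ord_p c_v(E^{(d_K)}) = ord_p c_v(E)`. Proof: x11b3's, letter for letter (split `v`: two degree-one
places, `d_K ∈ (ℚ_ℓ^×)²`; non-split `v`: `E`, `E_K` semistable there with `p ∤ ord(Δ_min)`, the twist
good or of type `I₀*`/`Iₙ*` with `c ∈ {1,2,4}`).
-- adapted from Summits/…/X11b/Three/RouteR1TamagawaPlaces.lean (`padicValNat_sum_fibre_eq_of_isErratumField`)
[cite: Castella2018, §5 (arXiv:1704.06608 p. 12), Tamagawa relation]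
[cite: SilvermanATAEC1994, IV.9.4 Steps 6–7 (PDF pp. 345–346)] -/
theorem padicValNat_sum_fibre_eq_of_erratumClauses_odd (W : WeierstrassCurve ℚ) [W.IsElliptic]
    [W.IsGloballyMinimal] (p : ℕ) [Fact p.Prime] (hp2 : p ≠ 2) (K : Type) [Field K] [NumberField K]
    [(W.baseChange K).IsElliptic] {q : ℕ} [Fact q.Prime] (hmq : Mult W q)
    (hvq : ¬ p ∣ padicValInt q W.minimalDiscriminantInt) (hK : IsImaginaryQuadratic K)
    (hqD : (q : ℤ) ∣ NumberField.discr K)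
    (hsplit : ∀ ℓ : ℕ, ℓ.Prime → ℓ ∣ W.conductorNorm ℤ → ℓ ≠ q →
      ((Ideal.span {(ℓ : ℤ)}).primesOver (𝓞 K)).ncard = 2)
    (h8 : NumberField.discr K % 8 = 1)
    (Wd : WeierstrassCurve ℚ) [Wd.IsElliptic] {C : VariableChange ℚ}
    (hC : C • W.quadraticTwist (NumberField.discr K : ℚ) = Wd) (v : HeightOneSpectrum (𝓞 ℚ)) :
    (∑ w ∈ (HeightOneSpectrum.finite_setOf_under_eq_of_numberField (K := K) v).toFinset,
        padicValNat p (((W.baseChange K).baseChange (w.adicCompletion K)).localTamagawaNumber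
          (w.adicCompletionIntegers K)) =
      padicValNat p ((W.baseChange (v.adicCompletion ℚ)).localTamagawaNumber
          (v.adicCompletionIntegers ℚ)) +
        padicValNat p ((Wd.baseChange (v.adicCompletion ℚ)).localTamagawaNumber
          (v.adicCompletionIntegers ℚ))) ∧
    padicValNat p ((Wd.baseChange (v.adicCompletion ℚ)).localTamagawaNumber
        (v.adicCompletionIntegers ℚ)) =
      padicValNat p ((W.baseChange (v.adicCompletion ℚ)).localTamagawaNumber
        (v.adicCompletionIntegers ℚ)) := by
  have hpr : p.Prime := Fact.out
  have hqP : q.Prime := Fact.out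
  have h2 : Module.finrank ℚ K = 2 := hK.1
  set ℓ : ℕ := (Rat.HeightOneSpectrum.primesEquiv v : ℕ) with hℓdef
  haveI hℓ : Fact ℓ.Prime := ⟨(Rat.HeightOneSpectrum.primesEquiv v).2⟩
  have hvℓ : (Rat.HeightOneSpectrum.primesEquiv v : ℕ) = ℓ := rfl
  have hd : (NumberField.discr K : ℚ) ≠ 0 := by exact_mod_cast NumberField.discr_ne_zero K
  have hdZ : (NumberField.discr K : ℤ) ≠ 0 := NumberField.discr_ne_zero K
  have hfin := HeightOneSpectrum.finite_setOf_under_eq_of_numberField (K := K) v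
  -- `d_K ≡ 1 (mod 8)` and `2 ∤ d_K` on an erratum field at an odd `q`
  have hodd2 : ¬ (2 : ℤ) ∣ NumberField.discr K := by omega
  -- the case of a single place `w` above `v` (inert or ramified): all three numbers are `p`-units
  have key : ∀ (w : HeightOneSpectrum (𝓞 K)) (e : ℕ),
      {w' : HeightOneSpectrum (𝓞 K) | w'.under (𝓞 ℚ) = v} = {w} →
      w.asIdeal.ramificationIdx (𝓞 ℚ) = e → 0 < e → e ≤ 2 →
      (∑ w ∈ hfin.toFinset,
          padicValNat p (((W.baseChange K).baseChange (w.adicCompletion K)).localTamagawaNumber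
            (w.adicCompletionIntegers K)) =
        padicValNat p ((W.baseChange (v.adicCompletion ℚ)).localTamagawaNumber
            (v.adicCompletionIntegers ℚ)) +
          padicValNat p ((Wd.baseChange (v.adicCompletion ℚ)).localTamagawaNumber
            (v.adicCompletionIntegers ℚ))) ∧
      padicValNat p ((Wd.baseChange (v.adicCompletion ℚ)).localTamagawaNumber
          (v.adicCompletionIntegers ℚ)) =
        padicValNat p ((W.baseChange (v.adicCompletion ℚ)).localTamagawaNumber
          (v.adicCompletionIntegers ℚ)) := by
    intro w e hset he he0 he2
    have hw : w.under (𝓞 ℚ) = v := by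
      have h : w ∈ ({w} : Set (HeightOneSpectrum (𝓞 K))) := Set.mem_singleton _
      rwa [← hset] at h
    haveI : w.asIdeal.LiesOver v.asIdeal := ⟨by rw [← hw]; rfl⟩
    have hF : hfin.toFinset = {w} := by
      ext w'
      rw [Set.Finite.mem_toFinset, hset]
      simp
    -- `ℓ` does not split in `K`
    have hns : ¬ SplitsIn K ℓ := by
      show ((Ideal.span {(ℓ : ℤ)}).primesOver (𝓞 K)).ncard ≠ 2
      rw [hℓdef, ncard_primesOver_span_eq K v, hset, Set.ncard_singleton]
      decide
    -- so a bad `ℓ` is the ramified prime `q`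
    have hℓq : ℓ ∣ W.conductorNorm ℤ → ℓ = q := fun hℓN => by
      by_contra hne
      exact hns (hsplit ℓ hℓ.out hℓN hne)
    -- `E` is semistable at `v`, with the `p`-adic `j`-hypothesis
    have hsemiW : W.HasGoodReductionAt v ∨ W.HasMultiplicativeReductionAt v := by
      by_cases hℓN : ℓ ∣ W.conductorNorm ℤ
      · exact Or.inr ((hasMultiplicativeReductionAtPrime_primesEquiv_iff_holds W v q (hℓq hℓN)).mp hmq)
      · exact Or.inl ((hasGoodReductionAtPrime_primesEquiv_iff_holds W v ℓ hvℓ).mp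
          (by
            by_contra hbad'
            exact hℓN ((W.dvd_conductorNorm_iff_not_hasGoodReductionAtPrime ℓ).mpr hbad')))
    have H : ∀ n : ℕ, 0 < n → v.valuation ℚ W.j = WithZero.exp (n : ℤ) → ¬ p ∣ n := by
      by_cases hℓN : ℓ ∣ W.conductorNorm ℤ
      · have hmv : W.HasMultiplicativeReductionAt v :=
          (hasMultiplicativeReductionAtPrime_primesEquiv_iff_holds W v q (hℓq hℓN)).mp hmq
        intro n hn hval
        rw [valuation_j_eq_exp_ordMinimalDiscriminant v W hmv, WithZero.exp_inj] at hval
        have hn' : n = W.ordMinimalDiscriminant v := by exact_mod_cast hval.symm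
        rw [hn', ordMinimalDiscriminant_eq_padicValInt W v (hℓq hℓN)]
        exact hvq
      · have hgood : W.HasGoodReductionAt v :=
          (hasGoodReductionAtPrime_primesEquiv_iff_holds W v ℓ hvℓ).mp
            (by
              by_contra hbad'
              exact hℓN ((W.dvd_conductorNorm_iff_not_hasGoodReductionAtPrime ℓ).mpr hbad'))
        have hj := Additive.valuation_j_le_one_of_hasGoodReductionAt W v hgood
        intro n hn hval
        exfalso
        rw [hval, ← WithZero.exp_zero, WithZero.exp_le_exp] at hj
        omega
    -- `E_K` is semistable at `w`
    have hsemiK : (W.baseChange K).HasGoodReductionAt w ∨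
        (W.baseChange K).HasMultiplicativeReductionAt w := by
      by_cases hℓN : ℓ ∣ W.conductorNorm ℤ
      · -- `w ∣ q`: multiplicative reduction is stable under base change
        have hvq' : v = (Rat.HeightOneSpectrum.primesEquiv (R := 𝓞 ℚ)).symm ⟨q, hqP⟩ := by
          rw [Equiv.eq_symm_apply]; exact Subtype.ext (hℓq hℓN)
        have hqv : (q : 𝓞 ℚ) ∈ v.asIdeal :=
          (natCast_mem_asIdeal_iff_eq_primesEquiv_symm v hqP).mpr hvq'
        have hmem : (q : 𝓞 ℚ) ∈ (w.under (𝓞 ℚ)).asIdeal := by rw [hw]; exact hqv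
        rw [HeightOneSpectrum.under_asIdeal, Ideal.under_def, Ideal.mem_comap, map_natCast] at hmem
        exact Or.inr
          (Additive.isMinimalAt_and_hasMultiplicativeReductionAt_baseChange_of_mult W hmq w hmem).2
      · have hgood : W.HasGoodReductionAt v :=
          (hasGoodReductionAtPrime_primesEquiv_iff_holds W v ℓ hvℓ).mp
            (by
              by_contra hbad'
              exact hℓN ((W.dvd_conductorNorm_iff_not_hasGoodReductionAtPrime ℓ).mpr hbad'))
        exact Or.inl (hasGoodReductionAt_baseChange_of_hasGoodReductionAt_rat W v w hgood)
    have hep : e < p := lt_of_le_of_lt he2 (by have := hpr.two_le; omega)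
    have hQ := padicValNat_localTamagawaNumber_eq_zero_of_semistable W v hp2 hsemiW H
    have hKw := padicValNat_localTamagawaNumber_eq_zero_of_semistable (W.baseChange K) w hp2 hsemiK
      (jHyp_baseChange W K w v hw hpr he he0 hep H)
    -- the twist at `v`
    have hD : padicValNat p ((Wd.baseChange (v.adicCompletion ℚ)).localTamagawaNumber
        (v.adicCompletionIntegers ℚ)) = 0 := by
      by_cases hℓd : ((Rat.HeightOneSpectrum.primesEquiv v : ℕ) : ℤ) ∣ NumberField.discr K
      · -- ramified `ℓ ∣ d_K`: `ℓ` odd, `ℓ ∥ d_K`, twist of Kodaira type `I₀*`/`Iₙ*`, `c ∈ {1, 2, 4}`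
        have hℓ2 : (Rat.HeightOneSpectrum.primesEquiv v : ℕ) ≠ 2 := by
          intro h
          apply hodd2
          have h' : (((Rat.HeightOneSpectrum.primesEquiv v : ℕ) : ℤ)) = 2 := by rw [h]; rfl
          rwa [h'] at hℓd
        have hsq : ¬ ((Rat.HeightOneSpectrum.primesEquiv v : ℕ) : ℤ) ^ 2 ∣ NumberField.discr K :=
          Literature.NumberTheory.QuadraticFields.Quadratic.not_sq_dvd_discr_of_prime_ne_two h2
            hℓ.out hℓ2
        have hmem := Additive.tamagawaNumberAt_twist_of_semistable_mem v W hℓ2 hdZ hℓd hsq hsemiW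
          C hC
        rw [tamagawaNumberAt_def] at hmem
        have h4 : ¬ p ∣ 4 := fun h => hp2 ((Nat.prime_dvd_prime_iff_eq hpr Nat.prime_two).mp
          (hpr.dvd_of_dvd_pow (show p ∣ 2 ^ 2 by simpa using h)))
        have h2' : ¬ p ∣ 2 := fun h => hp2 ((Nat.prime_dvd_prime_iff_eq hpr Nat.prime_two).mp h)
        rcases hmem with h | h | h <;> rw [h]
        · simp
        · exact padicValNat.eq_zero_of_not_dvd h2'
        · exact padicValNat.eq_zero_of_not_dvd h4
      · -- unramified `ℓ ∤ d_K`: `E` is good at `v` (a bad `ℓ` would be `q ∣ d_K`), so is the twist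
        have hℓN : ¬ ℓ ∣ W.conductorNorm ℤ := fun hℓN => by
          apply hℓd
          rw [hvℓ, hℓq hℓN]
          exact hqD
        have hgood : W.HasGoodReductionAt v :=
          (hasGoodReductionAtPrime_primesEquiv_iff_holds W v ℓ hvℓ).mp
            (by
              by_contra hbad'
              exact hℓN ((W.dvd_conductorNorm_iff_not_hasGoodReductionAtPrime ℓ).mpr hbad'))
        have hDk : NumberField.discr K = 4 * ((NumberField.discr K - 1) / 4) + 1 := by omega
        have hgoodd : Wd.HasGoodReductionAt v :=
          X2.hasGoodReductionAt_twist_of_not_dvd W v hDk hℓd hgood C hC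
        rw [localTamagawaNumber_eq_one_of_good' v Wd
          (WeierstrassCurve.localTamagawaNumber_eq_one_of_hasGoodReduction_holds _ _) hgoodd]
        simp
    rw [hF, Finset.sum_singleton, hKw, hQ, hD]
    exact ⟨rfl, rfl⟩
  rcases placesOver_trichotomy_of_finrank_eq_two K h2 v with
    ⟨w₁, w₂, hne, hset, hef⟩ | ⟨w, hset, he, -⟩ | ⟨w, hset, he, -⟩
  · -- split: two places of degree one, and `d_K` is a square in `ℚ_ℓ`
    have hw₁ : w₁.under (𝓞 ℚ) = v := by
      have h : w₁ ∈ ({w₁, w₂} : Set (HeightOneSpectrum (𝓞 K))) := Set.mem_insert _ _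
      rwa [← hset] at h
    have hw₂ : w₂.under (𝓞 ℚ) = v := by
      have h : w₂ ∈ ({w₁, w₂} : Set (HeightOneSpectrum (𝓞 K))) :=
        Set.mem_insert_of_mem _ (Set.mem_singleton _)
      rwa [← hset] at h
    obtain ⟨he₁, hf₁⟩ := hef w₁ hw₁
    obtain ⟨he₂, hf₂⟩ := hef w₂ hw₂
    have hF : hfin.toFinset = {w₁, w₂} := by
      ext w
      rw [Set.Finite.mem_toFinset, hset]
      simp
    have hs : SplitsIn K ℓ := by
      show ((Ideal.span {(ℓ : ℤ)}).primesOver (𝓞 K)).ncard = 2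
      rw [hℓdef, ncard_primesOver_span_eq K v, hset, Set.ncard_pair hne]
    have hsq := isSquare_padic_discr_of_splitsIn h2 hs
    have c₁ := localTamagawaNumber_baseChange_eq_of_degree_one W w₁ he₁ hf₁
    have c₂ := localTamagawaNumber_baseChange_eq_of_degree_one W w₂ he₂ hf₂
    rw [hw₁] at c₁
    rw [hw₂] at c₂
    rw [hF, Finset.sum_pair hne, c₁, c₂,
      localTamagawaNumber_eq_of_twist_of_isSquare W v hvℓ hd hsq Wd hC]
    exact ⟨rfl, rfl⟩
  · exact key w 1 hset he one_pos (by norm_num)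
  · exact key w 2 hset he two_pos le_rfl


/-! ### §2 (C) in clause form, and `d_K ≡ 1 (mod 8)` from the splitting clauses -/

/-- **(C) `X11b.TamagawaDescentAt W p K Wd` at every ODD `p`, CLAUSE form**: `K` imaginary quadratic,
`q ∣ d_K` for a multiplicative `q` with `p ∤ v_q(Δ_min)`, every other bad prime split in `K`,
`d_K ≡ 1 (mod 8)`; `Wd` any elliptic model of `E^{(d_K)}`. Assembly of §1 along the fibres of
`w ↦ w ∩ ℤ` by x11b3's `X11b.Three.padicValNat_tamagawaProduct_baseChange_of_fibrewise`.
-- adapted from Summits/…/X11b/Three/RouteR1Tamagawa.lean (`tamagawaDescentAt_of_isErratumField_odd`)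
[cite: Castella2018, §5 (arXiv:1704.06608 p. 12), Tamagawa relation] -/
theorem tamagawaDescentAt_of_erratumClauses_odd (W : WeierstrassCurve ℚ) [W.IsElliptic]
    [W.IsGloballyMinimal] (p : ℕ) [Fact p.Prime] (hp2 : p ≠ 2) (q : ℕ) [Fact q.Prime]
    (hmq : Mult W q) (hvq : ¬ p ∣ padicValInt q W.minimalDiscriminantInt)
    (K : Type) [Field K] [NumberField K] (hK : IsImaginaryQuadratic K)
    (hqD : (q : ℤ) ∣ NumberField.discr K)
    (hsplit : ∀ ℓ : ℕ, ℓ.Prime → ℓ ∣ W.conductorNorm ℤ → ℓ ≠ q →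
      ((Ideal.span {(ℓ : ℤ)}).primesOver (𝓞 K)).ncard = 2)
    (h8 : NumberField.discr K % 8 = 1)
    (Wd : WeierstrassCurve ℚ) [Wd.IsElliptic]
    (hWd : ∃ C : VariableChange ℚ, C • W.quadraticTwist (NumberField.discr K : ℚ) = Wd) :
    TamagawaDescentAt W p K Wd := by
  obtain ⟨C, hC⟩ := hWd
  haveI hEK : (W.baseChange K).IsElliptic := by rw [baseChange]; infer_instance
  exact padicValNat_tamagawaProduct_baseChange_of_fibrewise W p K Wd fun v =>
    (padicValNat_sum_fibre_eq_of_erratumClauses_odd W p hp2 K hmq hvq hK hqD hsplit h8 Wd hC v).1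

/-- **`d_K ≡ 1 (mod 8)` from the erratum splitting clauses at an ODD `q`**: `2` splits in `K` — if
`2 ∣ N` it is a bad prime other than `q`, else the `2`-clause applies — and for a quadratic field
`2` splits iff `d_K ≡ 1 (mod 8)` (`Quadratic.ncard_primesOver_two_eq_two_iff`; Marcus Ch. 3 Thm. 25).
[cite: Castella2018, §5 (arXiv:1704.06608 p. 12), the choice of K] -/
theorem discr_emod_eight_of_erratumClauses (W : WeierstrassCurve ℚ) {q : ℕ} (hq2 : q ≠ 2)
    (K : Type) [Field K] [NumberField K] (hK : IsImaginaryQuadratic K)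
    (hsplit : ∀ ℓ : ℕ, ℓ.Prime → ℓ ∣ W.conductorNorm ℤ → ℓ ≠ q →
      ((Ideal.span {(ℓ : ℤ)}).primesOver (𝓞 K)).ncard = 2)
    (h2s : ¬ 2 ∣ W.conductorNorm ℤ → ((Ideal.span {(2 : ℤ)}).primesOver (𝓞 K)).ncard = 2) :
    NumberField.discr K % 8 = 1 := by
  have h2 : ((Ideal.span {((2 : ℕ) : ℤ)}).primesOver (𝓞 K)).ncard = 2 := by
    by_cases h2N : 2 ∣ W.conductorNorm ℤ
    · exact hsplit 2 Nat.prime_two h2N (Ne.symm hq2)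
    · exact_mod_cast h2s h2N
  exact (Literature.NumberTheory.QuadraticFields.Quadratic.ncard_primesOver_two_eq_two_iff hK.1).mp h2

end Summit.BirchSwinnertonDyer.BirchSwinnertonDyer.Theorems.X8ErratumField

end
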